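import Summits.QuantumFields.YangMills.Theorems.BalabanUVNodesN15PerCubeGreenTwoGridCutRows
import Summits.QuantumFields.YangMills.Theorems.BalabanUVNodesN15PerCubeGreenAdjointRightEntries
import Summits.QuantumFields.YangMills.Theorems.BalabanUVNodesN15NeumannCubeGradientDefect
import HarnessLib

/-!
# N15 = NE2, road (c) — PROGRAMME (PC), (PC-E-K) ENTRY 2 OF (3.42) (ADJOINT ARRANGEMENT), SITE ROWS I: THE TWO-GRID η-DEFECTS OF THE SANDWICHED BACKWARD RIGHT ENTRIES
# `T⁻_k := M_{ψ_k}(G′(1)∘∇⁻_μ)M_{ψ_k}` OF THE PLATEAU-COMPRESSED TORUS GREEN's FUNCTIONS ON THE (PC) SITE CARRIERS, from dag-n15-a's flat two-grid row `G′(1)∂ᵀ` (Ξ-4 r11) by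
# EXACT algebra; the forward twins CONDITIONAL on the located row Ξ-4b (dag-n15-c g37, n15-c∕428a)

Cell `pub-ymgap`, seat `pub-ymgap-dag-n15-c` (generation g37; R134 (a) seat, strategy s1 «first missing estimate»; HUMAN RULING D-0062; chair R424 venue).
`bears_on: R4∕N15 · K3⁸ SpineGivenEndpointR13SepCoPHV (stmt-QuantumFields-27366)`; filed `--kind proof --supports stmt-QuantumFields-27366 --as helper` — COUNT-NEUTRAL.
THEOREMS only ([folklore] bookkeeping), 0 `def`, 0 `sorry`.  Imports BY NAME dag-n15-a ✓p794216 `…PerCubeGreenTwoGridCutRows` (`scPsi'_eq_scPsi_kingPr`, `scChi'_eq_scChi_kingPr`,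
`mulOp_scPsi'_comp_pull`, `pull_comp_mulOp_scChi`, `idef_comp_cut`, `liftBlk_scBlk_comp_liftMap_kingPr`; through it n15-c∕122 `idef_cut_comp` ∕ `hasMaj_tgt_congr`, n15-c∕261
`hasMaj_comp_mulOp_cut` ∕ `hasMaj_mulOp_cut_comp`, dag-n15-a `blockOf_mem_cubeBlocks_of_inner_ne_zero`, the site objects 260∕260′) and n15-c∕282a `…PerCubeGreenAdjointRightEntries`
(`hasMaj_ext`; its `mulVecLin_cgradT_comp_ext` ∕ `mulVecLin_comp_bgrad_eq` re-proved here on a GENERIC torus carrier `Tor (fine n M)` so that both grids are instances; through it n15-c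
`cgrad_one_transpose_mulVec`, `hasMaj_comp_diag`, `HasMaj.neg`).  Nothing in the tree is modified, no landed name re-declared.

WHY.  The site instantiation of n15-c∕427 (entry 2 of (3.42) at two grids, `U(N)` form) displays, per cube `k` and direction `μ`, the flat two-grid defects of the sandwiched right
entries of the plateau-compressed torus Green's function (n15-c∕283′'s one-grid objects): `hDTb`∕`hITb` (backward: `T⁻_k = M_{ψ_k}(G′(1)∘∇⁻_μ)M_{ψ_k}`, plain and cut two-sided) and
`hDTf`∕`hITf` (forward).  BACKWARD (this file, §3): `G∘∇⁻_μ = −(G∂ᵀ)∘ext_μ` (§1, any torus), the slice embedding COMMUTES EXACTLY with King's two pairings (`ext′_μ∘P̂_sites =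
P̂_bonds∘ext_μ`, `kingPrV = (kingPr, id)`, §2), the plateaus are ALIGNED (`ψ′_k = ψ_k∘π`, dag-n15-a), so `𝔇_{P̂}(T⁻′_k, T⁻_k) = −M_{ψ′_k}∘𝔇_{P̂_bonds,P̂_sites}(G″∂″ᵀ, G′∂′ᵀ)∘ext_μ∘M_{ψ_k}`
and dag-n15-a's Ξ-4 row r11 (taken as a DISPLAYED hypothesis `hDGA` at any masses, as ✓p794216 does) gives the row, two-sided localized by the plateaus (§3 ★★).  FORWARD (§4): the
same plumbing from a DISPLAYED site row `hDGF` of the shape of the located Ξ-4b (`𝔇_{P̂}(G″∘∇″⁺_μ, G′∘∇′⁺_μ)`; HOME NOTES.g37 — NOT derivable from Ξ-4 by majorant algebra: `∇⁺ = ∇⁻∘S`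
puts the shift on the source; its route is `G∇⁺ = S(G∇⁻) + G[S, aQ′ᵀQ′](G∇⁻)` + dag-n15-e's output-shift letters).

RESULTS ([folklore]; `X = ScX`, `X′ = ScX′`, `π = kingPr L kk r (cvM…)`, `blk = scBlk`, `S_k = cvSk k`, `η⁻¹ = ((L^k)⁻¹)⁻¹`, `η′⁻¹ = ((L^rL^k)⁻¹)⁻¹` as in n15-c∕339).
* §1 `mulVecLin_cgradT_comp_ext_gen`, `mulVecLin_comp_bgrad_gen` (any `Tor (fine n M)`), §2 `ext_comp_pull_kingPr`, `idef_comp_inter` (`𝔇_{τ₁,τ₂}(A′∘E′, A∘E) = 𝔇_{τ₁′,τ₂}(A′,A)∘E` when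
  `E′∘τ₁ = τ₁′∘E`) (negation: dag-n15-a's `TwoGrid.idef_neg_neg`, imported);
* §3 ★★ `hasMaj_idef_scT_bgrad` (two-sided `1_□1_□·K`), `hasMaj_idef_scT_bgrad_plain` (427's `hDTb` shape), ★★ `hasMaj_idef_cut_scT_bgrad` (427's `hITb` shape);
* §4 ★ `hasMaj_idef_scT_fgrad`, `hasMaj_idef_scT_fgrad_plain`, ★ `hasMaj_idef_cut_scT_fgrad` (427's `hDTf`∕`hITf` shapes from a Ξ-4b-shaped displayed site row).

HONEST FRAMING ∕ LIMITS.  Exact operator algebra on MODEL carriers over DISPLAYED flat rows (King's `A = 0` statements; the backward row is a theorem in the tree, Ξ-4; the forward row is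
LOCATED, not claimed); nothing of [B5]∕[B6]∕[B9] asserted ((3.42) p.397, (3.62)–(3.65) pp.402–403, Thm 3.14 pp.426–427 = SHAPES ∕ TEMPLATE; [King1986] p.664 = pairing, Lemma 4.5 (4.38)
p.674 = the `A = 0` template).  NE2⁺ NOT PRINTED, NOT proved; N15 of record untouched (DISCHARGED AS CONSUMED, p687738); K3⁸ OPEN; counts of record UNMOVED (typed 28∕28 · discharged
8∕27); one finite 𝕋⁴ at fixed ε per index — NOT infinite volume, NOT OS on ℝ⁴, NOT a mass gap, NOT Clay.  Restate-immune (no Theses import).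
-/

noncomputable section

open scoped BigOperators Matrix

namespace Summit.QuantumFields.YangMills.BalabanUVNodes.N15.Gluing

open Literature.MathematicalPhysics.QuantumFieldTheory.Balaban1983to89
open Literature.MathematicalPhysics.QuantumFieldTheory.Balaban1983to89.B5Prop11Plancherel (Tor fine unitVec)
open Literature.MathematicalPhysics.QuantumFieldTheory.Balaban1983to89.B11SectG (BlockNorm HasMaj)
open Literature.MathematicalPhysics.QuantumFieldTheory.Balaban1983to89.B6Prop26Gluing (mulOp mulOp_apply ind ind_nonneg ind_le_one)
open Literature.MathematicalPhysics.QuantumFieldTheory.Balaban1983to89.B6UnitTorusCarrier (unitTorusGeo unitTorusGeo_dist)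
open Literature.MathematicalPhysics.QuantumFieldTheory.Balaban1983to89.T4EtaRateDefect (idef)
open Literature.MathematicalPhysics.QuantumFieldTheory.Balaban1983to89.T4EtaRateCoeffDefect (pull pull_apply diagK hasMaj_mulOp)
open Literature.MathematicalPhysics.QuantumFieldTheory.King1986.Torus (blockOf tdistT)
open Summit.QuantumFields.YangMills.BalabanUVNodes.N15.BackgroundLayer (fgrad bgrad bgrad_apply)
open Summit.QuantumFields.YangMills.BalabanUVNodes.N15.MatrixSpecies (liftBlk liftMap liftEquiv liftEquiv_apply liftEquiv_symm_apply)
open Summit.QuantumFields.YangMills.BalabanUVNodes.N15.VectorPiece (kingPr kingPrV kingPrV_eq)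
open Summit.QuantumFields.YangMills.BalabanUVNodes.N15.TwoGrid (chiCube cubeBlocks chiCube_of_not_mem abs_chiCube_le_one)
open Summit.QuantumFields.YangMills.BalabanUVNodes.N15.CovLandau (cgrad cGreen cgrad_one_transpose_mulVec)

variable {d : ℕ}

/-! ## §1 `G∘∇⁻_μ = −(G∂ᵀ)∘ext_μ` on any torus -/

section Generic

variable {M : Fin (d + 1) → ℕ} [∀ μ, NeZero (M μ)] {n : ℕ} [NeZero n] (ι : Type) [Fintype ι] [DecidableEq ι]

/-- `∂ᵀ∘ext_μ = −∇⁻_μ` on every torus `Tor (fine n M)` (n15-c∕282a's `mulVecLin_cgradT_comp_ext`, generic carrier). [cite: Balaban1984PropagatorsI, (1.3)–(1.4) p.18 (shape)] -/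
theorem mulVecLin_cgradT_comp_ext_gen (μ : Fin (d + 1)) :
    Matrix.mulVecLin ((cgrad M n (fun (_ : Fin (d + 1)) (_ : Tor (fine n M)) => (1 : Matrix ι ι ℝ)))ᵀ) ∘ₗ
        (mulOp (fun b : (Tor (fine n M) × Fin (d + 1)) × ι => if b.1.2 = μ then (1 : ℝ) else 0) ∘ₗ pull (fun b : (Tor (fine n M) × Fin (d + 1)) × ι => (b.1.1, b.2))) =
      -bgrad ((n : ℕ) : ℝ) (liftEquiv (Equiv.addRight (unitVec (fine n M) μ)) ι) := by
  classical
  refine LinearMap.ext fun f => funext fun p => ?_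
  obtain ⟨x, i⟩ := p
  rw [LinearMap.comp_apply, Matrix.mulVecLin_apply, cgrad_one_transpose_mulVec, LinearMap.neg_apply, Pi.neg_apply, bgrad_apply]
  simp only [LinearMap.comp_apply, mulOp_apply, pull_apply, liftEquiv_symm_apply, Equiv.addRight_symm, Equiv.coe_addRight, ite_mul, one_mul, zero_mul, ← sub_eq_add_neg]
  rw [Finset.sum_eq_single μ (fun ν _ hν => by rw [if_neg hν, if_neg hν, sub_zero, mul_zero]) (fun h => (h (Finset.mem_univ _)).elim)]
  simp only [if_true]
  ring

/-- `G∘∇⁻_μ = −(G∂ᵀ)∘ext_μ` for every site matrix `G` on every torus. [folklore] -/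
theorem mulVecLin_comp_bgrad_gen (G : Matrix (Tor (fine n M) × ι) (Tor (fine n M) × ι) ℝ) (μ : Fin (d + 1)) :
    Matrix.mulVecLin G ∘ₗ bgrad ((n : ℕ) : ℝ) (liftEquiv (Equiv.addRight (unitVec (fine n M) μ)) ι) =
      -(Matrix.mulVecLin (G * (cgrad M n (fun (_ : Fin (d + 1)) (_ : Tor (fine n M)) => (1 : Matrix ι ι ℝ)))ᵀ) ∘ₗ
        (mulOp (fun b : (Tor (fine n M) × Fin (d + 1)) × ι => if b.1.2 = μ then (1 : ℝ) else 0) ∘ₗ pull (fun b : (Tor (fine n M) × Fin (d + 1)) × ι => (b.1.1, b.2)))) := by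
  rw [Matrix.mulVecLin_mul, LinearMap.comp_assoc, mulVecLin_cgradT_comp_ext_gen, LinearMap.comp_neg, neg_neg]

end Generic

/-! ## §2 The slice embedding and King's two pairings; a defect with intertwined right factors; negation -/

section Pairing

variable {L : ℕ} [NeZero L] {mv kk r : ℕ} {hL : Odd L ∧ 1 < L} (ι : Type)

omit [NeZero L] in
/-- `ext′_μ∘P̂_sites = P̂_bonds∘ext_μ` (the bond pairing is the site pairing on base points, same direction). [cite: King1986, p.664 (pairing convention)] -/
theorem ext_comp_pull_kingPr (μ : Fin (d + 1)) :
    (mulOp (fun b : (ScX' d L mv kk r hL × Fin (d + 1)) × ι => if b.1.2 = μ then (1 : ℝ) else 0) ∘ₗ pull (fun b : (ScX' d L mv kk r hL × Fin (d + 1)) × ι => (b.1.1, b.2))) ∘ₗ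
        pull (liftMap (kingPr L kk r (cvM d L mv kk hL)) ι) =
      pull (liftMap (kingPrV L kk r (cvM d L mv kk hL)) ι) ∘ₗ
        (mulOp (fun b : (ScX d L mv kk hL × Fin (d + 1)) × ι => if b.1.2 = μ then (1 : ℝ) else 0) ∘ₗ pull (fun b : (ScX d L mv kk hL × Fin (d + 1)) × ι => (b.1.1, b.2))) := by
  refine LinearMap.ext fun f => funext fun b => ?_
  simp only [LinearMap.comp_apply, mulOp_apply, pull_apply, liftMap, kingPrV_eq]

omit [NeZero L] in
/-- `𝔇_{τ₁,τ₂}(A′∘E′, A∘E) = 𝔇_{τ₁′,τ₂}(A′, A)∘E` whenever the right factors intertwine the source pairings, `E′∘τ₁ = τ₁′∘E`. [folklore] -/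
theorem idef_comp_inter {F₁ F₁' G G' F₂ F₂' : Type} [AddCommGroup F₁] [Module ℝ F₁] [AddCommGroup F₁'] [Module ℝ F₁'] [AddCommGroup G] [Module ℝ G] [AddCommGroup G'] [Module ℝ G']
    [AddCommGroup F₂] [Module ℝ F₂] [AddCommGroup F₂'] [Module ℝ F₂'] {τ₁ : F₁ →ₗ[ℝ] F₁'} {τ₁' : G →ₗ[ℝ] G'} (τ₂ : F₂ →ₗ[ℝ] F₂') {E : F₁ →ₗ[ℝ] G} {E' : F₁' →ₗ[ℝ] G'}
    (h : E' ∘ₗ τ₁ = τ₁' ∘ₗ E) (A' : G' →ₗ[ℝ] F₂') (A : G →ₗ[ℝ] F₂) : idef τ₁ τ₂ (A' ∘ₗ E') (A ∘ₗ E) = idef τ₁' τ₂ A' A ∘ₗ E := by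
  simp only [idef, LinearMap.sub_comp, LinearMap.comp_assoc, h]

end Pairing

/-! ## §3 The two-grid defects of the sandwiched BACKWARD right entries on sites -/

section Backward

variable {L : ℕ} [NeZero L] {mv kk r : ℕ} {hL : Odd L ∧ 1 < L} (ι : Type) [Fintype ι] [DecidableEq ι]
/-- ★★ **THE TWO-GRID η-DEFECT OF THE SANDWICHED BACKWARD RIGHT ENTRY** `T⁻_k = M_{ψ_k}(G′(1)∘∇⁻_μ)M_{ψ_k}` (fine `a′`, coarse `a`) through King's site pairing, two-sided localized over
the cube's blocks, from the flat two-grid row of `G′(1)∂ᵀ` (Ξ-4 r11 shape, DISPLAYED as `hDGA`): `𝔇_{P̂}(T⁻′_k, T⁻_k) ≤ 1_□(y)1_□(y′)·K(y,y′)`.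
[cite: Balaban1985BackgroundPropagators, (3.42) p.397 (entry `G′∇*` at `U ≡ 1`: shape), Thm 3.14 pp.426–427 (difference template); King1986, p.664 (pairing), Lemma 4.5 (4.38) p.674 (the `A = 0` template)] -/
theorem hasMaj_idef_scT_bgrad {a a' : ℝ} {K : Tor (cvM d L mv kk hL) → Tor (cvM d L mv kk hL) → ℝ} (hK : ∀ y y', 0 ≤ K y y') (μ : Fin (d + 1))
    (hDGA : HasMaj (BlockNorm.ofBlocks (unitTorusGeo L kk (cvM d L mv kk hL)) (liftBlk (fun b : ScX d L mv kk hL × Fin (d + 1) => blockOf (L ^ kk) (cvM d L mv kk hL) b.1) ι))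
      (BlockNorm.ofBlocks (unitTorusGeo L kk (cvM d L mv kk hL)) (liftBlk (blockOf (L ^ r * L ^ kk) (cvM d L mv kk hL)) ι))
      (idef (pull (liftMap (kingPrV L kk r (cvM d L mv kk hL)) ι)) (pull (liftMap (kingPr L kk r (cvM d L mv kk hL)) ι))
        (Matrix.mulVecLin (cGreen (cvM d L mv kk hL) (L ^ r * L ^ kk) (fun (_ : Fin (d + 1)) (_ : ScX' d L mv kk r hL) => (1 : Matrix ι ι ℝ)) a' *
          (cgrad (cvM d L mv kk hL) (L ^ r * L ^ kk) (fun (_ : Fin (d + 1)) (_ : ScX' d L mv kk r hL) => (1 : Matrix ι ι ℝ)))ᵀ))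
        (Matrix.mulVecLin (cGreen (cvM d L mv kk hL) (L ^ kk) (fun (_ : Fin (d + 1)) (_ : ScX d L mv kk hL) => (1 : Matrix ι ι ℝ)) a *
          (cgrad (cvM d L mv kk hL) (L ^ kk) (fun (_ : Fin (d + 1)) (_ : ScX d L mv kk hL) => (1 : Matrix ι ι ℝ)))ᵀ))) K)
    (k : Fin (d + 1) → ZMod (2 * L)) :
    HasMaj (ScNorm d L mv kk hL ι) (BlockNorm.ofBlocks (unitTorusGeo L kk (cvM d L mv kk hL)) (liftBlk (scBlk d L mv kk hL) ι ∘ liftMap (kingPr L kk r (cvM d L mv kk hL)) ι))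
      (idef (pull (liftMap (kingPr L kk r (cvM d L mv kk hL)) ι)) (pull (liftMap (kingPr L kk r (cvM d L mv kk hL)) ι))
        (mulOp (fun p : ScX' d L mv kk r hL × ι => scPsi' d L mv kk r hL k p.1) ∘ₗ
          ((Matrix.mulVecLin (cGreen (cvM d L mv kk hL) (L ^ r * L ^ kk) (fun (_ : Fin (d + 1)) (_ : ScX' d L mv kk r hL) => (1 : Matrix ι ι ℝ)) a')) ∘ₗ
            bgrad ((((L ^ r * L ^ kk : ℕ) : ℝ))⁻¹)⁻¹ (liftEquiv (scShift' d L mv kk r hL μ) ι)) ∘ₗ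
          mulOp (fun p : ScX' d L mv kk r hL × ι => scPsi' d L mv kk r hL k p.1))
        (mulOp (fun p : ScX d L mv kk hL × ι => scPsi d L mv kk hL k p.1) ∘ₗ
          ((Matrix.mulVecLin (cGreen (cvM d L mv kk hL) (L ^ kk) (fun (_ : Fin (d + 1)) (_ : ScX d L mv kk hL) => (1 : Matrix ι ι ℝ)) a)) ∘ₗ
            bgrad ((((L ^ kk : ℕ) : ℝ))⁻¹)⁻¹ (liftEquiv (scShift d L mv kk hL μ) ι)) ∘ₗ
          mulOp (fun p : ScX d L mv kk hL × ι => scPsi d L mv kk hL k p.1)))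
      (fun y y' => ind (cvSk d L mv kk hL k) y * ind (cvSk d L mv kk hL k) y' * K y y') := by
  rw [inv_inv, inv_inv]
  have ec := mulVecLin_comp_bgrad_gen (M := cvM d L mv kk hL) (n := L ^ kk) ι (cGreen (cvM d L mv kk hL) (L ^ kk) (fun (_ : Fin (d + 1)) (_ : ScX d L mv kk hL) => (1 : Matrix ι ι ℝ)) a) μ
  have ef := mulVecLin_comp_bgrad_gen (M := cvM d L mv kk hL) (n := L ^ r * L ^ kk) ι (cGreen (cvM d L mv kk hL) (L ^ r * L ^ kk) (fun (_ : Fin (d + 1)) (_ : ScX' d L mv kk r hL) => (1 : Matrix ι ι ℝ)) a') μ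
  erw [ec, ef]
  rw [idef_cut_comp _ _ ((mulOp_scPsi'_comp_pull (d := d) (hL := hL) ι k).symm), idef_comp_cut _ (mulOp_scPsi'_comp_pull (d := d) (hL := hL) ι k), TwoGrid.idef_neg_neg,
    idef_comp_inter _ (ext_comp_pull_kingPr (d := d) (hL := hL) ι μ)]
  -- the row: Ξ-4 r11 ∘ the slice isometry, negated, then the two plateau cuts
  have h0 := ((hasMaj_comp_diag _ hK hDGA ((hasMaj_ext ι μ).mono fun y y' => le_of_eq (one_mul _))).mono fun y y' => le_of_eq (mul_one (K y y'))).neg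
  have h1 := hasMaj_comp_mulOp_cut (b₂ := BlockNorm.ofBlocks (unitTorusGeo L kk (cvM d L mv kk hL)) (liftBlk (blockOf (L ^ r * L ^ kk) (cvM d L mv kk hL)) ι))
    (liftBlk (scBlk d L mv kk hL) ι) hK (S := cvSk d L mv kk hL k) (χ := fun p : ScX d L mv kk hL × ι => scPsi d L mv kk hL k p.1) (fun p => abs_chiCube_le_one _ _)
    (fun p hp => Finset.mem_coe.mpr (by by_contra h; exact hp (chiCube_of_not_mem h))) h0
  have h2 := hasMaj_mulOp_cut_comp (b₁ := ScNorm d L mv kk hL ι) (liftBlk (scBlk d L mv kk hL) ι ∘ liftMap (kingPr L kk r (cvM d L mv kk hL)) ι)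
    (fun y y' => mul_nonneg (ind_nonneg _ _) (hK y y')) (S := cvSk d L mv kk hL k) (χ := fun p : ScX' d L mv kk r hL × ι => scPsi' d L mv kk r hL k p.1)
    (fun p => abs_chiCube_le_one _ _)
    (fun p hp => Finset.mem_coe.mpr (by rw [scPsi'_eq_scPsi_kingPr] at hp; by_contra h; exact hp (chiCube_of_not_mem h)))
    (hasMaj_tgt_congr (liftBlk_scBlk_comp_liftMap_kingPr (d := d) (hL := hL) ι).symm h1)
  exact h2.mono fun y y' => le_of_eq (by ring)

/-- … the PLAIN form (n15-c∕427's `hDTb`: drop the indicators). [folklore] -/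
theorem hasMaj_idef_scT_bgrad_plain {a a' : ℝ} {K : Tor (cvM d L mv kk hL) → Tor (cvM d L mv kk hL) → ℝ} (hK : ∀ y y', 0 ≤ K y y') (μ : Fin (d + 1))
    (hDGA : HasMaj (BlockNorm.ofBlocks (unitTorusGeo L kk (cvM d L mv kk hL)) (liftBlk (fun b : ScX d L mv kk hL × Fin (d + 1) => blockOf (L ^ kk) (cvM d L mv kk hL) b.1) ι))
      (BlockNorm.ofBlocks (unitTorusGeo L kk (cvM d L mv kk hL)) (liftBlk (blockOf (L ^ r * L ^ kk) (cvM d L mv kk hL)) ι))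
      (idef (pull (liftMap (kingPrV L kk r (cvM d L mv kk hL)) ι)) (pull (liftMap (kingPr L kk r (cvM d L mv kk hL)) ι))
        (Matrix.mulVecLin (cGreen (cvM d L mv kk hL) (L ^ r * L ^ kk) (fun (_ : Fin (d + 1)) (_ : ScX' d L mv kk r hL) => (1 : Matrix ι ι ℝ)) a' *
          (cgrad (cvM d L mv kk hL) (L ^ r * L ^ kk) (fun (_ : Fin (d + 1)) (_ : ScX' d L mv kk r hL) => (1 : Matrix ι ι ℝ)))ᵀ))
        (Matrix.mulVecLin (cGreen (cvM d L mv kk hL) (L ^ kk) (fun (_ : Fin (d + 1)) (_ : ScX d L mv kk hL) => (1 : Matrix ι ι ℝ)) a *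
          (cgrad (cvM d L mv kk hL) (L ^ kk) (fun (_ : Fin (d + 1)) (_ : ScX d L mv kk hL) => (1 : Matrix ι ι ℝ)))ᵀ))) K)
    (k : Fin (d + 1) → ZMod (2 * L)) :
    HasMaj (ScNorm d L mv kk hL ι) (BlockNorm.ofBlocks (unitTorusGeo L kk (cvM d L mv kk hL)) (liftBlk (scBlk d L mv kk hL) ι ∘ liftMap (kingPr L kk r (cvM d L mv kk hL)) ι)) (idef (pull (liftMap (kingPr L kk r (cvM d L mv kk hL)) ι)) (pull (liftMap (kingPr L kk r (cvM d L mv kk hL)) ι)) (mulOp (fun p : ScX' d L mv kk r hL × ι => scPsi' d L mv kk r hL k p.1) ∘ₗ ((Matrix.mulVecLin (cGreen (cvM d L mv kk hL) (L ^ r * L ^ kk) (fun (_ : Fin (d + 1)) (_ : ScX' d L mv kk r hL) => (1 : Matrix ι ι ℝ)) a')) ∘ₗ bgrad ((((L ^ r * L ^ kk : ℕ) : ℝ))⁻¹)⁻¹ (liftEquiv (scShift' d L mv kk r hL μ) ι)) ∘ₗ mulOp (fun p : ScX' d L mv kk r hL × ι => scPsi' d L mv kk r hL k p.1)) (mulOp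 (fun p : ScX d L mv kk hL × ι => scPsi d L mv kk hL k p.1) ∘ₗ ((Matrix.mulVecLin (cGreen (cvM d L mv kk hL) (L ^ kk) (fun (_ : Fin (d + 1)) (_ : ScX d L mv kk hL) => (1 : Matrix ι ι ℝ)) a)) ∘ₗ bgrad ((((L ^ kk : ℕ) : ℝ))⁻¹)⁻¹ (liftEquiv (scShift d L mv kk hL μ) ι)) ∘ₗ mulOp (fun p : ScX d L mv kk hL × ι => scPsi d L mv kk hL k p.1))) K :=
  (hasMaj_idef_scT_bgrad ι hK μ hDGA k).mono fun y y' => mul_le_of_le_one_left (hK y y') (mul_le_one₀ (ind_le_one _ _) (ind_nonneg _ _) (ind_le_one _ _))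

/-- ★★ … and CUT by the box indicators `χ′_k`, `χ_k` (n15-c∕427's `hITb`; `|χ′| ≤ 1`, the aligned cut commutes with the pairing). [cite: Balaban1985BackgroundPropagators, (3.62)–(3.65) pp.402–403 (shape)] -/
theorem hasMaj_idef_cut_scT_bgrad {a a' : ℝ} {K : Tor (cvM d L mv kk hL) → Tor (cvM d L mv kk hL) → ℝ} (hK : ∀ y y', 0 ≤ K y y') (μ : Fin (d + 1))
    (hDGA : HasMaj (BlockNorm.ofBlocks (unitTorusGeo L kk (cvM d L mv kk hL)) (liftBlk (fun b : ScX d L mv kk hL × Fin (d + 1) => blockOf (L ^ kk) (cvM d L mv kk hL) b.1) ι))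
      (BlockNorm.ofBlocks (unitTorusGeo L kk (cvM d L mv kk hL)) (liftBlk (blockOf (L ^ r * L ^ kk) (cvM d L mv kk hL)) ι))
      (idef (pull (liftMap (kingPrV L kk r (cvM d L mv kk hL)) ι)) (pull (liftMap (kingPr L kk r (cvM d L mv kk hL)) ι))
        (Matrix.mulVecLin (cGreen (cvM d L mv kk hL) (L ^ r * L ^ kk) (fun (_ : Fin (d + 1)) (_ : ScX' d L mv kk r hL) => (1 : Matrix ι ι ℝ)) a' *
          (cgrad (cvM d L mv kk hL) (L ^ r * L ^ kk) (fun (_ : Fin (d + 1)) (_ : ScX' d L mv kk r hL) => (1 : Matrix ι ι ℝ)))ᵀ))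
        (Matrix.mulVecLin (cGreen (cvM d L mv kk hL) (L ^ kk) (fun (_ : Fin (d + 1)) (_ : ScX d L mv kk hL) => (1 : Matrix ι ι ℝ)) a *
          (cgrad (cvM d L mv kk hL) (L ^ kk) (fun (_ : Fin (d + 1)) (_ : ScX d L mv kk hL) => (1 : Matrix ι ι ℝ)))ᵀ))) K)
    (k : Fin (d + 1) → ZMod (2 * L)) :
    HasMaj (ScNorm d L mv kk hL ι) (BlockNorm.ofBlocks (unitTorusGeo L kk (cvM d L mv kk hL)) (liftBlk (scBlk d L mv kk hL) ι ∘ liftMap (kingPr L kk r (cvM d L mv kk hL)) ι)) (idef (pull (liftMap (kingPr L kk r (cvM d L mv kk hL)) ι)) (pull (liftMap (kingPr L kk r (cvM d L mv kk hL)) ι)) (mulOp (fun p : ScX' d L mv kk r hL × ι => scChi' d L mv kk r hL k p.1) ∘ₗ (mulOp (fun p : ScX' d L mv kk r hL × ι => scPsi' d L mv kk r hL k p.1) ∘ₗ ((Matrix.mulVecLin (cGreen (cvM d L mv kk hL) (L ^ r * L ^ kk) (fun (_ : Fin (d + 1)) (_ : ScX' d L mv kk r hL) => (1 : Matrix ι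 ι ℝ)) a')) ∘ₗ bgrad ((((L ^ r * L ^ kk : ℕ) : ℝ))⁻¹)⁻¹ (liftEquiv (scShift' d L mv kk r hL μ) ι)) ∘ₗ mulOp (fun p : ScX' d L mv kk r hL × ι => scPsi' d L mv kk r hL k p.1))) (mulOp (fun p : ScX d L mv kk hL × ι => scChi d L mv kk hL k p.1) ∘ₗ (mulOp (fun p : ScX d L mv kk hL × ι => scPsi d L mv kk hL k p.1) ∘ₗ ((Matrix.mulVecLin (cGreen (cvM d L mv kk hL) (L ^ kk) (fun (_ : Fin (d + 1)) (_ : ScX d L mv kk hL) => (1 : Matrix ι ι ℝ)) a)) ∘ₗ bgrad ((((L ^ kk : ℕ) : ℝ))⁻¹)⁻¹ (liftEquiv (scShift d L mv kk hL μ) ι)) ∘ₗ mulOp (fun p : ScX d L mv kk hL × ι => scPsi d L mv kk hL k p.1)))) (fun y y' => ind (cvSk d L mv kk hL k) y * ind (cvSk d L mv kk hL k) y' * K y y') := by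
  rw [idef_cut_comp _ _ (pull_comp_mulOp_scChi (d := d) (hL := hL) ι k)]
  exact (hasMaj_diag_comp _ (fun _ => zero_le_one) (hasMaj_mulOp (g := unitTorusGeo L kk (cvM d L mv kk hL)) _ (m := fun _ => (1 : ℝ)) (fun _ => zero_le_one)
    (fun p : ScX' d L mv kk r hL × ι => abs_chiCube_le_one _ _)) (hasMaj_idef_scT_bgrad ι hK μ hDGA k)).mono fun y y' => le_of_eq (one_mul _)

end Backward

/-! ## §4 The forward twins, CONDITIONAL on the located site row Ξ-4b -/

section Forward

variable {L : ℕ} [NeZero L] {mv kk r : ℕ} {hL : Odd L ∧ 1 < L} (ι : Type) [Fintype ι] [DecidableEq ι]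

/-- ★ **THE TWO-GRID η-DEFECT OF THE SANDWICHED FORWARD RIGHT ENTRY** `T⁺_k = M_{ψ_k}(G′(1)∘∇⁺_μ)M_{ψ_k}`, two-sided localized, from a DISPLAYED site row of the located shape Ξ-4b
(`𝔇_{P̂}(G″∘∇″⁺_μ, G′∘∇′⁺_μ) ≤ K`; NOT derivable from Ξ-4 by majorant algebra — HOME NOTES.g37). [cite: Balaban1985BackgroundPropagators, (3.42) p.397 (shape), Thm 3.14 pp.426–427 (template); King1986, p.664, Lemma 4.5 (4.38) p.674] -/
theorem hasMaj_idef_scT_fgrad {a a' : ℝ} {K : Tor (cvM d L mv kk hL) → Tor (cvM d L mv kk hL) → ℝ} (hK : ∀ y y', 0 ≤ K y y') (μ : Fin (d + 1))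
    (hDGF : HasMaj (ScNorm d L mv kk hL ι) (BlockNorm.ofBlocks (unitTorusGeo L kk (cvM d L mv kk hL)) (liftBlk (blockOf (L ^ r * L ^ kk) (cvM d L mv kk hL)) ι))
      (idef (pull (liftMap (kingPr L kk r (cvM d L mv kk hL)) ι)) (pull (liftMap (kingPr L kk r (cvM d L mv kk hL)) ι))
        (Matrix.mulVecLin (cGreen (cvM d L mv kk hL) (L ^ r * L ^ kk) (fun (_ : Fin (d + 1)) (_ : ScX' d L mv kk r hL) => (1 : Matrix ι ι ℝ)) a') ∘ₗ fgrad ((((L ^ r * L ^ kk : ℕ) : ℝ))⁻¹)⁻¹ (liftEquiv (scShift' d L mv kk r hL μ) ι))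
        (Matrix.mulVecLin (cGreen (cvM d L mv kk hL) (L ^ kk) (fun (_ : Fin (d + 1)) (_ : ScX d L mv kk hL) => (1 : Matrix ι ι ℝ)) a) ∘ₗ fgrad ((((L ^ kk : ℕ) : ℝ))⁻¹)⁻¹ (liftEquiv (scShift d L mv kk hL μ) ι))) K)
    (k : Fin (d + 1) → ZMod (2 * L)) :
    HasMaj (ScNorm d L mv kk hL ι) (BlockNorm.ofBlocks (unitTorusGeo L kk (cvM d L mv kk hL)) (liftBlk (scBlk d L mv kk hL) ι ∘ liftMap (kingPr L kk r (cvM d L mv kk hL)) ι)) (idef (pull (liftMap (kingPr L kk r (cvM d L mv kk hL)) ι)) (pull (liftMap (kingPr L kk r (cvM d L mv kk hL)) ι)) (mulOp (fun p : ScX' d L mv kk r hL × ι => scPsi' d L mv kk r hL k p.1) ∘ₗ ((Matrix.mulVecLin (cGreen (cvM d L mv kk hL) (L ^ r * L ^ kk) (fun (_ : Fin (d + 1)) (_ : ScX' d L mv kk r hL) => (1 : Matrix ι ι ℝ)) a')) ∘ₗ fgrad ((((L ^ r * L ^ kk : ℕ) : ℝ))⁻¹)⁻¹ (liftEquiv (scShift'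 d L mv kk r hL μ) ι)) ∘ₗ mulOp (fun p : ScX' d L mv kk r hL × ι => scPsi' d L mv kk r hL k p.1)) (mulOp (fun p : ScX d L mv kk hL × ι => scPsi d L mv kk hL k p.1) ∘ₗ ((Matrix.mulVecLin (cGreen (cvM d L mv kk hL) (L ^ kk) (fun (_ : Fin (d + 1)) (_ : ScX d L mv kk hL) => (1 : Matrix ι ι ℝ)) a)) ∘ₗ fgrad ((((L ^ kk : ℕ) : ℝ))⁻¹)⁻¹ (liftEquiv (scShift d L mv kk hL μ) ι)) ∘ₗ mulOp (fun p : ScX d L mv kk hL × ι => scPsi d L mv kk hL k p.1))) (fun y y' => ind (cvSk d L mv kk hL k) y * ind (cvSk d L mv kk hL k) y' * K y y') := by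
  rw [idef_cut_comp _ _ ((mulOp_scPsi'_comp_pull (d := d) (hL := hL) ι k).symm), idef_comp_cut _ (mulOp_scPsi'_comp_pull (d := d) (hL := hL) ι k)]
  have h1 := hasMaj_comp_mulOp_cut (b₂ := BlockNorm.ofBlocks (unitTorusGeo L kk (cvM d L mv kk hL)) (liftBlk (blockOf (L ^ r * L ^ kk) (cvM d L mv kk hL)) ι))
    (liftBlk (scBlk d L mv kk hL) ι) hK (S := cvSk d L mv kk hL k) (χ := fun p : ScX d L mv kk hL × ι => scPsi d L mv kk hL k p.1) (fun p => abs_chiCube_le_one _ _)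
    (fun p hp => Finset.mem_coe.mpr (by by_contra h; exact hp (chiCube_of_not_mem h))) hDGF
  have h2 := hasMaj_mulOp_cut_comp (b₁ := ScNorm d L mv kk hL ι) (liftBlk (scBlk d L mv kk hL) ι ∘ liftMap (kingPr L kk r (cvM d L mv kk hL)) ι)
    (fun y y' => mul_nonneg (ind_nonneg _ _) (hK y y')) (S := cvSk d L mv kk hL k) (χ := fun p : ScX' d L mv kk r hL × ι => scPsi' d L mv kk r hL k p.1)
    (fun p => abs_chiCube_le_one _ _)
    (fun p hp => Finset.mem_coe.mpr (by rw [scPsi'_eq_scPsi_kingPr] at hp; by_contra h; exact hp (chiCube_of_not_mem h)))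
    (hasMaj_tgt_congr (liftBlk_scBlk_comp_liftMap_kingPr (d := d) (hL := hL) ι).symm h1)
  exact h2.mono fun y y' => le_of_eq (by ring)

/-- … the PLAIN form (n15-c∕427's `hDTf`). [folklore] -/
theorem hasMaj_idef_scT_fgrad_plain {a a' : ℝ} {K : Tor (cvM d L mv kk hL) → Tor (cvM d L mv kk hL) → ℝ} (hK : ∀ y y', 0 ≤ K y y') (μ : Fin (d + 1))
    (hDGF : HasMaj (ScNorm d L mv kk hL ι) (BlockNorm.ofBlocks (unitTorusGeo L kk (cvM d L mv kk hL)) (liftBlk (blockOf (L ^ r * L ^ kk) (cvM d L mv kk hL)) ι))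
      (idef (pull (liftMap (kingPr L kk r (cvM d L mv kk hL)) ι)) (pull (liftMap (kingPr L kk r (cvM d L mv kk hL)) ι))
        (Matrix.mulVecLin (cGreen (cvM d L mv kk hL) (L ^ r * L ^ kk) (fun (_ : Fin (d + 1)) (_ : ScX' d L mv kk r hL) => (1 : Matrix ι ι ℝ)) a') ∘ₗ fgrad ((((L ^ r * L ^ kk : ℕ) : ℝ))⁻¹)⁻¹ (liftEquiv (scShift' d L mv kk r hL μ) ι))
        (Matrix.mulVecLin (cGreen (cvM d L mv kk hL) (L ^ kk) (fun (_ : Fin (d + 1)) (_ : ScX d L mv kk hL) => (1 : Matrix ι ι ℝ)) a) ∘ₗ fgrad ((((L ^ kk : ℕ) : ℝ))⁻¹)⁻¹ (liftEquiv (scShift d L mv kk hL μ) ι))) K)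
    (k : Fin (d + 1) → ZMod (2 * L)) :
    HasMaj (ScNorm d L mv kk hL ι) (BlockNorm.ofBlocks (unitTorusGeo L kk (cvM d L mv kk hL)) (liftBlk (scBlk d L mv kk hL) ι ∘ liftMap (kingPr L kk r (cvM d L mv kk hL)) ι)) (idef (pull (liftMap (kingPr L kk r (cvM d L mv kk hL)) ι)) (pull (liftMap (kingPr L kk r (cvM d L mv kk hL)) ι)) (mulOp (fun p : ScX' d L mv kk r hL × ι => scPsi' d L mv kk r hL k p.1) ∘ₗ ((Matrix.mulVecLin (cGreen (cvM d L mv kk hL) (L ^ r * L ^ kk) (fun (_ : Fin (d + 1)) (_ : ScX' d L mv kk r hL) => (1 : Matrix ι ι ℝ)) a')) ∘ₗ fgrad ((((L ^ r * L ^ kk : ℕ) : ℝ))⁻¹)⁻¹ (liftEquiv (scShift' d L mv kk r hL μ) ι)) ∘ₗ mulOp (fun p : ScX' d L mv kk r hL × ι => scPsi' d L mv kk r hL k p.1)) (mulOp (fun p : ScX d L mv kk hL × ι => scPsi d L mv kk hL k p.1) ∘ₗ ((Matrix.mulVecLin (cGreen (cvM d L mv kk hL) (L ^ kk) (fun (_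 : Fin (d + 1)) (_ : ScX d L mv kk hL) => (1 : Matrix ι ι ℝ)) a)) ∘ₗ fgrad ((((L ^ kk : ℕ) : ℝ))⁻¹)⁻¹ (liftEquiv (scShift d L mv kk hL μ) ι)) ∘ₗ mulOp (fun p : ScX d L mv kk hL × ι => scPsi d L mv kk hL k p.1))) K :=
  (hasMaj_idef_scT_fgrad ι hK μ hDGF k).mono fun y y' => mul_le_of_le_one_left (hK y y') (mul_le_one₀ (ind_le_one _ _) (ind_nonneg _ _) (ind_le_one _ _))

/-- ★ … and CUT by `χ′_k`, `χ_k` (n15-c∕427's `hITf`). [cite: Balaban1985BackgroundPropagators, (3.62)–(3.65) pp.402–403 (shape)] -/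
theorem hasMaj_idef_cut_scT_fgrad {a a' : ℝ} {K : Tor (cvM d L mv kk hL) → Tor (cvM d L mv kk hL) → ℝ} (hK : ∀ y y', 0 ≤ K y y') (μ : Fin (d + 1))
    (hDGF : HasMaj (ScNorm d L mv kk hL ι) (BlockNorm.ofBlocks (unitTorusGeo L kk (cvM d L mv kk hL)) (liftBlk (blockOf (L ^ r * L ^ kk) (cvM d L mv kk hL)) ι))
      (idef (pull (liftMap (kingPr L kk r (cvM d L mv kk hL)) ι)) (pull (liftMap (kingPr L kk r (cvM d L mv kk hL)) ι))
        (Matrix.mulVecLin (cGreen (cvM d L mv kk hL) (L ^ r * L ^ kk) (fun (_ : Fin (d + 1)) (_ : ScX' d L mv kk r hL) => (1 : Matrix ι ι ℝ)) a') ∘ₗ fgrad ((((L ^ r * L ^ kk : ℕ) : ℝ))⁻¹)⁻¹ (liftEquiv (scShift' d L mv kk r hL μ) ι))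
        (Matrix.mulVecLin (cGreen (cvM d L mv kk hL) (L ^ kk) (fun (_ : Fin (d + 1)) (_ : ScX d L mv kk hL) => (1 : Matrix ι ι ℝ)) a) ∘ₗ fgrad ((((L ^ kk : ℕ) : ℝ))⁻¹)⁻¹ (liftEquiv (scShift d L mv kk hL μ) ι))) K)
    (k : Fin (d + 1) → ZMod (2 * L)) :
    HasMaj (ScNorm d L mv kk hL ι) (BlockNorm.ofBlocks (unitTorusGeo L kk (cvM d L mv kk hL)) (liftBlk (scBlk d L mv kk hL) ι ∘ liftMap (kingPr L kk r (cvM d L mv kk hL)) ι)) (idef (pull (liftMap (kingPr L kk r (cvM d L mv kk hL)) ι)) (pull (liftMap (kingPr L kk r (cvM d L mv kk hL)) ι)) (mulOp (fun p : ScX' d L mv kk r hL × ι => scChi' d L mv kk r hL k p.1) ∘ₗ (mulOp (fun p : ScX' d L mv kk r hL × ι => scPsi' d L mv kk r hL k p.1) ∘ₗ ((Matrix.mulVecLin (cGreen (cvM d L mv kk hL) (L ^ r * L ^ kk) (fun (_ : Fin (d + 1)) (_ : ScX' d L mv kk r hL) => (1 : Matrix ι ι ℝ)) a')) ∘ₗ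 fgrad ((((L ^ r * L ^ kk : ℕ) : ℝ))⁻¹)⁻¹ (liftEquiv (scShift' d L mv kk r hL μ) ι)) ∘ₗ mulOp (fun p : ScX' d L mv kk r hL × ι => scPsi' d L mv kk r hL k p.1))) (mulOp (fun p : ScX d L mv kk hL × ι => scChi d L mv kk hL k p.1) ∘ₗ (mulOp (fun p : ScX d L mv kk hL × ι => scPsi d L mv kk hL k p.1) ∘ₗ ((Matrix.mulVecLin (cGreen (cvM d L mv kk hL) (L ^ kk) (fun (_ : Fin (d + 1)) (_ : ScX d L mv kk hL) => (1 : Matrix ι ι ℝ)) a)) ∘ₗ fgrad ((((L ^ kk : ℕ) : ℝ))⁻¹)⁻¹ (liftEquiv (scShift d L mv kk hL μ) ι)) ∘ₗ mulOp (fun p : ScX d L mv kk hL × ι => scPsi d L mv kk hL k p.1)))) (fun y y' => ind (cvSk d L mv kk hL k) y * ind (cvSk d L mv kk hL k) y' * K y y') := by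
  rw [idef_cut_comp _ _ (pull_comp_mulOp_scChi (d := d) (hL := hL) ι k)]
  exact (hasMaj_diag_comp _ (fun _ => zero_le_one) (hasMaj_mulOp (g := unitTorusGeo L kk (cvM d L mv kk hL)) _ (m := fun _ => (1 : ℝ)) (fun _ => zero_le_one)
    (fun p : ScX' d L mv kk r hL × ι => abs_chiCube_le_one _ _)) (hasMaj_idef_scT_fgrad ι hK μ hDGF k)).mono fun y y' => le_of_eq (one_mul _)

end Forward

end Summit.QuantumFields.YangMills.BalabanUVNodes.N15.Gluing

end
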